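import Summits.QuantumFields.BalabanUV.T4Continuum.Support.ShellMeasureLandauHolonomy
import Summits.QuantumFields.BalabanUV.T4Continuum.Support.ShellMeasurePinnedNorm

/-!
# `T4Continuum.ShellMeasureLandauPinnedTransfer` — row S70 companion «T» (TWO-NORM TRANSFER): the flat canonical solution
# `solAt` of the Prop.-6 scheme and the flat canonical Landau correction `corrAt` ∕ exponent `landauExp` ARE the images of the
# pinned ones — «`solAt` is the same point in both norms» as a kernel statement

(cell `pub-balaban`, `t4`, NE7c; unit `b2b-balaban-t4-ne7c-formalise-leaf-04` gen 5 (written, staged UNFILED, journal l.16332) ∕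
gen 6 (§4 + filing); owner table v3.1 row **S70** «END-II-loc: THE LD CHAIN IN TWO NORMS» (holder leaf-01-g6: «file it if you wish, it
is the clean statement of «`solAt` is the same point in both norms» … the dictionary items my f3 header lists as DISPLAYED», journal
l.16766 (3); companion f2 «the fixed points pinned» = leaf-07-g6 `ShellMeasureLandauPinnedFixedPoint`∕`…Field`, the COMPLEMENTARY
a-priori route — no declaration of theirs is restated here); ADDITIVE — imports the LD f-file `ShellMeasureLandauHolonomy` (`solAt`,
`corrAt`, `landauExp`) and S69 `ShellMeasurePinnedNorm` (`pinW`, `norm_toPiL_le_of_nonneg`; hence S65 f2a `WSup.toPiL`) ONLY; 0 def,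
0 `def … : Prop`, 0 sorry, 0 citation tag; [folklore] throughout.)

HONEST FRAMING.  Finite four-torus programme, rung (B)+1 only — NOT infinite volume, NOT a mass gap, NOT the Clay problem.  NE7c is
NOT PRINTED and NOT PROVED; «NE7c ⇐ the named binders» (+ the decay halves at live levels, FINDING F-ne7cp1-g30-1).  Pure functional
analysis on OUR side: nothing of the manuscripts is asserted.  HONEST DEPENDENCY: continuum YM on T⁴ ⇐ BetaPertH ∧ nine spine
estimates (0/9 proved); BetaPertH ⇐ (D1) ∧ (D4) ∧ CAP+tail; G-an2-4 gates asym, D1 and NE2/3/4.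

THE POINT.  The locality road (rows S69–S71) re-runs the LD chain with the SAME underlying maps read in a second, PINNED norm
(S69 `WSup (pinW δ′ ϖ) 1`, identity `toPiL : pinned ≃L flat`, flat norm ≤ pinned norm).  END-II's dictionary `hRdict`∕`hudict` and
every `…landauChart*` END are written with the FLAT canonical objects `solAt 𝒢 Λ W ε₄ J 𝔄` (B11 Prop. 6's solution, a
`Classical.epsilon` in the flat ball `‖X‖ ≤ ε₄`) and `corrAt C ι H r Y` ∕ `landauExp` ([B11] (47)∕(50)).  This file proves that
CONJUGATING the scheme by continuous linear equivalences `e : 𝒴ₚ ≃L[ℂ] 𝒴`, `eZ : 𝒵ₚ ≃L[ℂ] 𝒵` (resp. `eX`, `eY'`) commutes with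
`mapT` ∕ with the correction equation, and that — as soon as `e` is NORM-DECREASING, the conjugated (pinned) problem HAS a solution in
its ball of radius `ε₄′ ≤ ε₄` and the flat problem has UNIQUENESS in its ball — the flat canonical solution IS the image of the
pinned one: `solAt 𝒢 Λ W ε₄ J 𝔄 = e (solAt 𝒢ₚ Λₚ Wₚ ε₄′ Jₚ 𝔄ₚ)`, whence its PINNED bound `‖e.symm (solAt …)‖ ≤ ε₄′`; likewise for
`corrAt` and `landauExp`.  So S70 f3 (`ShellMeasureLandauPinnedEnd`, dictionary item (iii) «`solAt` contracts in whatever norm `𝒴`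
carries») may run B11Prop6Scheme ∕ the Sect.-C fixed point VERBATIM at the pinned space `𝒴 := WSup (pinW δ′ ϖ) 1 𝔄` (pinned
operator bounds from S69 (A)) and read the conclusions back on the FLAT objects END-II of record names — §4 is that instance
(`e := WSup.toPiL (pinW δ′ ϖ) 1`, norm-decreasing by S69 `norm_toPiL_le_of_nonneg` for `δ′ ≥ 0`, `ϖ ≥ 0`) — no second dictionary.

WHAT IS PROVED ([folklore]).  §1 `mapT_conj` (conjugation identity), `isFixedPt_conj_iff`; §2 `solAt_eq_conj` (flat canonical
solution = image of ANY pinned fixed point in a ball mapped into the flat ball, under flat uniqueness), `solAt_eq_map_solAt`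
(= image of the pinned canonical solution), `norm_symm_solAt_le` (the pinned bound); §3 `corr_conj` ∕ `corrAt_eq_map_corrAt` ∕
`landauExp_eq_map_landauExp` (the same for the Landau correction (50) and the exponent (47)); §4 THE PINNED INSTANCE
`solAt_eq_toPiL_solAt` ∕ `norm_toPiL_symm_solAt_le`: for the flat configuration space `S → 𝔄` and S69's pinned reading
`WSup (pinW δ′ ϖ) 1 𝔄` (`0 ≤ δ′`, `0 ≤ ϖ`), the flat canonical solution is `toPiL` of the pinned canonical solution and its PINNED
norm is `≤ ε₄′`.  NOT HERE: the pinned EXISTENCE and the flat UNIQUENESS themselves (B11Prop6Scheme `existsUnique_solution` ∕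
`ShellMeasureLandauFixedPoint` at the respective spaces — hypotheses here, by name there), the pinned operator bounds (S69 (A) ∕
S70 f1), the a-priori variation estimates (leaf-07-g6's f2), any identification with Bałaban's objects ([dict]).  (B11 = [Balaban
1985 Variational problem], equation numbers LOCATE shapes only; nothing printed is asserted.)
-/

noncomputable section

open Metric Set Function

namespace Summit.QuantumFields.BalabanUV.T4Continuum.ShellMeasureLandauPinnedTransfer

open Literature.MathematicalPhysics.QuantumFieldTheory.Balaban1983to89
open B11Prop6Scheme (mapT mapT_apply)
open Summit.QuantumFields.BalabanUV.T4Continuum.ShellMeasureLandauHolonomy (solAt solAt_spec solAt_eq_of_unique corrAt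
  corrAt_spec corrAt_eq_of_unique landauExp landauExp_apply)

variable {𝒴 𝒵 𝒴ₚ 𝒵ₚ : Type*} [NormedAddCommGroup 𝒴] [NormedSpace ℂ 𝒴] [NormedAddCommGroup 𝒵] [NormedSpace ℂ 𝒵]
  [NormedAddCommGroup 𝒴ₚ] [NormedSpace ℂ 𝒴ₚ] [NormedAddCommGroup 𝒵ₚ] [NormedSpace ℂ 𝒵ₚ]

/-! ## §1 Conjugating the scheme by continuous linear equivalences -/

/-- **THE CONJUGATION IDENTITY**: with `𝒢ₚ = e⁻¹𝒢eZ`, `Λₚ = e⁻¹Λe`, `Wₚ = eZ⁻¹∘W∘e`, `Jₚ = eZ⁻¹J`, `𝔄ₚ = e⁻¹𝔄`, the scheme map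
commutes with `e`: `e (mapT 𝒢ₚ Λₚ Wₚ Jₚ 𝔄ₚ X) = mapT 𝒢 Λ W J 𝔄 (e X)`. [folklore] -/
theorem mapT_conj (e : 𝒴ₚ ≃L[ℂ] 𝒴) (eZ : 𝒵ₚ ≃L[ℂ] 𝒵) (𝒢 : 𝒵 →L[ℂ] 𝒴) (Λ : 𝒴 →L[ℂ] 𝒴) (W : 𝒴 → 𝒵) (J : 𝒵)
    (𝔄 : 𝒴) (X : 𝒴ₚ) :
    e (mapT ((e.symm : 𝒴 →L[ℂ] 𝒴ₚ).comp (𝒢.comp (eZ : 𝒵ₚ →L[ℂ] 𝒵)))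
        ((e.symm : 𝒴 →L[ℂ] 𝒴ₚ).comp (Λ.comp (e : 𝒴ₚ →L[ℂ] 𝒴))) (fun Y => eZ.symm (W (e Y))) (eZ.symm J)
        (e.symm 𝔄) X) = mapT 𝒢 Λ W J 𝔄 (e X) := by
  simp only [mapT_apply, map_sub, map_add, map_neg, ContinuousLinearMap.coe_comp, ContinuousLinearEquiv.coe_coe,
    Function.comp_apply, ContinuousLinearEquiv.apply_symm_apply]

/-- Fixed points correspond under the conjugation. [folklore] -/
theorem isFixedPt_conj_iff (e : 𝒴ₚ ≃L[ℂ] 𝒴) (eZ : 𝒵ₚ ≃L[ℂ] 𝒵) (𝒢 : 𝒵 →L[ℂ] 𝒴) (Λ : 𝒴 →L[ℂ] 𝒴) (W : 𝒴 → 𝒵)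
    (J : 𝒵) (𝔄 : 𝒴) (X : 𝒴ₚ) :
    mapT ((e.symm : 𝒴 →L[ℂ] 𝒴ₚ).comp (𝒢.comp (eZ : 𝒵ₚ →L[ℂ] 𝒵)))
        ((e.symm : 𝒴 →L[ℂ] 𝒴ₚ).comp (Λ.comp (e : 𝒴ₚ →L[ℂ] 𝒴))) (fun Y => eZ.symm (W (e Y))) (eZ.symm J)
        (e.symm 𝔄) X = X ↔ mapT 𝒢 Λ W J 𝔄 (e X) = e X := by
  rw [← mapT_conj e eZ 𝒢 Λ W J 𝔄 X]
  exact ⟨fun h => by rw [h], fun h => e.injective h⟩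

/-! ## §2 The flat canonical solution is the image of the pinned one -/

/-- **TRANSFER OF THE CANONICAL SOLUTION.**  If `e` is norm-decreasing (`‖e x‖ ≤ ‖x‖`: flat norm ≤ pinned norm), the conjugated
problem has SOME fixed point `Xₚ` with `‖Xₚ‖ ≤ ε₄′ ≤ ε₄`, and the flat problem has at most one fixed point in `‖X‖ ≤ ε₄`, then
`solAt 𝒢 Λ W ε₄ J 𝔄 = e Xₚ`. [folklore] -/
theorem solAt_eq_conj (e : 𝒴ₚ ≃L[ℂ] 𝒴) (eZ : 𝒵ₚ ≃L[ℂ] 𝒵) (he : ∀ x, ‖e x‖ ≤ ‖x‖) (𝒢 : 𝒵 →L[ℂ] 𝒴)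
    (Λ : 𝒴 →L[ℂ] 𝒴) (W : 𝒴 → 𝒵) (J : 𝒵) (𝔄 : 𝒴) {ε₄ ε₄' : ℝ} (hε : ε₄' ≤ ε₄) {Xₚ : 𝒴ₚ} (hXₚ : ‖Xₚ‖ ≤ ε₄')
    (hfix : mapT ((e.symm : 𝒴 →L[ℂ] 𝒴ₚ).comp (𝒢.comp (eZ : 𝒵ₚ →L[ℂ] 𝒵)))
        ((e.symm : 𝒴 →L[ℂ] 𝒴ₚ).comp (Λ.comp (e : 𝒴ₚ →L[ℂ] 𝒴))) (fun Y => eZ.symm (W (e Y))) (eZ.symm J)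
        (e.symm 𝔄) Xₚ = Xₚ)
    (huniq : ∀ X' : 𝒴, ‖X'‖ ≤ ε₄ → mapT 𝒢 Λ W J 𝔄 X' = X' → ∀ X'' : 𝒴, ‖X''‖ ≤ ε₄ → mapT 𝒢 Λ W J 𝔄 X'' = X'' →
      X' = X'') :
    solAt 𝒢 Λ W ε₄ J 𝔄 = e Xₚ := by
  have hflat : ‖e Xₚ‖ ≤ ε₄ := ((he Xₚ).trans hXₚ).trans hε
  have hfix' : mapT 𝒢 Λ W J 𝔄 (e Xₚ) = e Xₚ := (isFixedPt_conj_iff e eZ 𝒢 Λ W J 𝔄 Xₚ).1 hfix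
  exact solAt_eq_of_unique hflat hfix' fun X' hX' hX'fix => huniq X' hX' hX'fix (e Xₚ) hflat hfix'

/-- **… in particular the image of the PINNED CANONICAL SOLUTION** (which exists as soon as some pinned fixed point does).
[folklore] -/
theorem solAt_eq_map_solAt (e : 𝒴ₚ ≃L[ℂ] 𝒴) (eZ : 𝒵ₚ ≃L[ℂ] 𝒵) (he : ∀ x, ‖e x‖ ≤ ‖x‖) (𝒢 : 𝒵 →L[ℂ] 𝒴)
    (Λ : 𝒴 →L[ℂ] 𝒴) (W : 𝒴 → 𝒵) (J : 𝒵) (𝔄 : 𝒴) {ε₄ ε₄' : ℝ} (hε : ε₄' ≤ ε₄)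
    (hex : ∃ Xₚ : 𝒴ₚ, ‖Xₚ‖ ≤ ε₄' ∧ mapT ((e.symm : 𝒴 →L[ℂ] 𝒴ₚ).comp (𝒢.comp (eZ : 𝒵ₚ →L[ℂ] 𝒵)))
        ((e.symm : 𝒴 →L[ℂ] 𝒴ₚ).comp (Λ.comp (e : 𝒴ₚ →L[ℂ] 𝒴))) (fun Y => eZ.symm (W (e Y))) (eZ.symm J)
        (e.symm 𝔄) Xₚ = Xₚ)
    (huniq : ∀ X' : 𝒴, ‖X'‖ ≤ ε₄ → mapT 𝒢 Λ W J 𝔄 X' = X' → ∀ X'' : 𝒴, ‖X''‖ ≤ ε₄ → mapT 𝒢 Λ W J 𝔄 X'' = X'' →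
      X' = X'') :
    solAt 𝒢 Λ W ε₄ J 𝔄 =
      e (solAt ((e.symm : 𝒴 →L[ℂ] 𝒴ₚ).comp (𝒢.comp (eZ : 𝒵ₚ →L[ℂ] 𝒵)))
        ((e.symm : 𝒴 →L[ℂ] 𝒴ₚ).comp (Λ.comp (e : 𝒴ₚ →L[ℂ] 𝒴))) (fun Y => eZ.symm (W (e Y))) ε₄' (eZ.symm J)
        (e.symm 𝔄)) := by
  have hsp := solAt_spec (𝒢 := (e.symm : 𝒴 →L[ℂ] 𝒴ₚ).comp (𝒢.comp (eZ : 𝒵ₚ →L[ℂ] 𝒵)))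
    (Λ := (e.symm : 𝒴 →L[ℂ] 𝒴ₚ).comp (Λ.comp (e : 𝒴ₚ →L[ℂ] 𝒴))) (W := fun Y => eZ.symm (W (e Y))) hex
  exact solAt_eq_conj e eZ he 𝒢 Λ W J 𝔄 hε hsp.1 hsp.2 huniq

/-- **THE PINNED BOUND OF THE FLAT CANONICAL SOLUTION**: under the same hypotheses `‖e⁻¹ (solAt 𝒢 Λ W ε₄ J 𝔄)‖ ≤ ε₄′`.
[folklore] -/
theorem norm_symm_solAt_le (e : 𝒴ₚ ≃L[ℂ] 𝒴) (eZ : 𝒵ₚ ≃L[ℂ] 𝒵) (he : ∀ x, ‖e x‖ ≤ ‖x‖) (𝒢 : 𝒵 →L[ℂ] 𝒴)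
    (Λ : 𝒴 →L[ℂ] 𝒴) (W : 𝒴 → 𝒵) (J : 𝒵) (𝔄 : 𝒴) {ε₄ ε₄' : ℝ} (hε : ε₄' ≤ ε₄)
    (hex : ∃ Xₚ : 𝒴ₚ, ‖Xₚ‖ ≤ ε₄' ∧ mapT ((e.symm : 𝒴 →L[ℂ] 𝒴ₚ).comp (𝒢.comp (eZ : 𝒵ₚ →L[ℂ] 𝒵)))
        ((e.symm : 𝒴 →L[ℂ] 𝒴ₚ).comp (Λ.comp (e : 𝒴ₚ →L[ℂ] 𝒴))) (fun Y => eZ.symm (W (e Y))) (eZ.symm J)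
        (e.symm 𝔄) Xₚ = Xₚ)
    (huniq : ∀ X' : 𝒴, ‖X'‖ ≤ ε₄ → mapT 𝒢 Λ W J 𝔄 X' = X' → ∀ X'' : 𝒴, ‖X''‖ ≤ ε₄ → mapT 𝒢 Λ W J 𝔄 X'' = X'' →
      X' = X'') :
    ‖e.symm (solAt 𝒢 Λ W ε₄ J 𝔄)‖ ≤ ε₄' := by
  obtain ⟨Xₚ, hXₚ, hfix⟩ := hex
  rw [solAt_eq_conj e eZ he 𝒢 Λ W J 𝔄 hε hXₚ hfix huniq, ContinuousLinearEquiv.symm_apply_apply]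
  exact hXₚ

/-! ## §3 The same for the Landau correction (50) and the Landau exponent (47) -/

section Corr

variable {𝒴' 𝒳 𝒴'ₚ 𝒳ₚ : Type*} [NormedAddCommGroup 𝒴'] [NormedSpace ℂ 𝒴'] [NormedAddCommGroup 𝒳] [NormedSpace ℂ 𝒳]
  [NormedAddCommGroup 𝒴'ₚ] [NormedSpace ℂ 𝒴'ₚ] [NormedAddCommGroup 𝒳ₚ] [NormedSpace ℂ 𝒳ₚ]

/-- **CONJUGATION OF THE CORRECTION EQUATION (50)** `C(ιY − ιH X′) = X′`: with `Cₚ = eX⁻¹∘C∘eY′`, `ιₚ = eY′⁻¹ιe`, `Hₚ = e⁻¹HeX`,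
`eX (Cₚ (ιₚ Yₚ − ιₚ (Hₚ X′ₚ))) = C (ι (e Yₚ) − ι (H (eX X′ₚ)))`. [folklore] -/
theorem corr_conj (e : 𝒴ₚ ≃L[ℂ] 𝒴) (eX : 𝒳ₚ ≃L[ℂ] 𝒳) (eY' : 𝒴'ₚ ≃L[ℂ] 𝒴') (C : 𝒴' → 𝒳) (ι : 𝒴 →L[ℂ] 𝒴')
    (H : 𝒳 →L[ℂ] 𝒴) (Yₚ : 𝒴ₚ) (X'ₚ : 𝒳ₚ) :
    eX ((fun Z => eX.symm (C (eY' Z)))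
        (((eY'.symm : 𝒴' →L[ℂ] 𝒴'ₚ).comp (ι.comp (e : 𝒴ₚ →L[ℂ] 𝒴))) Yₚ -
          ((eY'.symm : 𝒴' →L[ℂ] 𝒴'ₚ).comp (ι.comp (e : 𝒴ₚ →L[ℂ] 𝒴)))
            (((e.symm : 𝒴 →L[ℂ] 𝒴ₚ).comp (H.comp (eX : 𝒳ₚ →L[ℂ] 𝒳))) X'ₚ)))
      = C (ι (e Yₚ) - ι (H (eX X'ₚ))) := by
  simp only [ContinuousLinearMap.coe_comp, ContinuousLinearEquiv.coe_coe, Function.comp_apply,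
    ContinuousLinearEquiv.apply_symm_apply, ← map_sub]

/-- **TRANSFER OF THE CANONICAL LANDAU CORRECTION**: if `eX` is norm-decreasing, the conjugated equation has SOME fixed point in
`closedBall 0 r′`, `r′ ≤ r`, and the flat equation has at most one fixed point in `closedBall 0 r`, then
`corrAt C ι H r (e Yₚ) = eX (corrAt Cₚ ιₚ Hₚ r′ Yₚ)`. [folklore] -/
theorem corrAt_eq_map_corrAt (e : 𝒴ₚ ≃L[ℂ] 𝒴) (eX : 𝒳ₚ ≃L[ℂ] 𝒳) (eY' : 𝒴'ₚ ≃L[ℂ] 𝒴') (heX : ∀ x, ‖eX x‖ ≤ ‖x‖)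
    (C : 𝒴' → 𝒳) (ι : 𝒴 →L[ℂ] 𝒴') (H : 𝒳 →L[ℂ] 𝒴) {r r' : ℝ} (hr : r' ≤ r) (Yₚ : 𝒴ₚ)
    (hex : ∃ X'ₚ : 𝒳ₚ, X'ₚ ∈ closedBall (0 : 𝒳ₚ) r' ∧ (fun Z => eX.symm (C (eY' Z)))
        (((eY'.symm : 𝒴' →L[ℂ] 𝒴'ₚ).comp (ι.comp (e : 𝒴ₚ →L[ℂ] 𝒴))) Yₚ -
          ((eY'.symm : 𝒴' →L[ℂ] 𝒴'ₚ).comp (ι.comp (e : 𝒴ₚ →L[ℂ] 𝒴)))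
            (((e.symm : 𝒴 →L[ℂ] 𝒴ₚ).comp (H.comp (eX : 𝒳ₚ →L[ℂ] 𝒳))) X'ₚ)) = X'ₚ)
    (huniq : ∀ X' ∈ closedBall (0 : 𝒳) r, C (ι (e Yₚ) - ι (H X')) = X' →
      ∀ X'' ∈ closedBall (0 : 𝒳) r, C (ι (e Yₚ) - ι (H X'')) = X'' → X' = X'') :
    corrAt C ι H r (e Yₚ) =
      eX (corrAt (fun Z => eX.symm (C (eY' Z))) ((eY'.symm : 𝒴' →L[ℂ] 𝒴'ₚ).comp (ι.comp (e : 𝒴ₚ →L[ℂ] 𝒴)))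
        ((e.symm : 𝒴 →L[ℂ] 𝒴ₚ).comp (H.comp (eX : 𝒳ₚ →L[ℂ] 𝒳))) r' Yₚ) := by
  have hsp := corrAt_spec (C := fun Z => eX.symm (C (eY' Z)))
    (ι := (eY'.symm : 𝒴' →L[ℂ] 𝒴'ₚ).comp (ι.comp (e : 𝒴ₚ →L[ℂ] 𝒴)))
    (H := (e.symm : 𝒴 →L[ℂ] 𝒴ₚ).comp (H.comp (eX : 𝒳ₚ →L[ℂ] 𝒳))) (r := r') (Y := Yₚ) hex
  set Dₚ := corrAt (fun Z => eX.symm (C (eY' Z))) ((eY'.symm : 𝒴' →L[ℂ] 𝒴'ₚ).comp (ι.comp (e : 𝒴ₚ →L[ℂ] 𝒴)))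
    ((e.symm : 𝒴 →L[ℂ] 𝒴ₚ).comp (H.comp (eX : 𝒳ₚ →L[ℂ] 𝒳))) r' Yₚ with hD
  have hball : eX Dₚ ∈ closedBall (0 : 𝒳) r := by
    have h1 := hsp.1
    rw [mem_closedBall_zero_iff] at h1 ⊢
    exact ((heX Dₚ).trans h1).trans hr
  have hfix : C (ι (e Yₚ) - ι (H (eX Dₚ))) = eX Dₚ := by
    have h2 := congrArg eX hsp.2
    rwa [corr_conj] at h2
  exact corrAt_eq_of_unique hball hfix fun X'' hX'' hX''fix => huniq X'' hX'' hX''fix (eX Dₚ) hball hfix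

/-- **TRANSFER OF THE LANDAU EXPONENT (47)** `Y − HD(Y)`: under the hypotheses of `corrAt_eq_map_corrAt`,
`landauExp C ι H r (e Yₚ) = e (landauExp Cₚ ιₚ Hₚ r′ Yₚ)`. [folklore] -/
theorem landauExp_eq_map_landauExp (e : 𝒴ₚ ≃L[ℂ] 𝒴) (eX : 𝒳ₚ ≃L[ℂ] 𝒳) (eY' : 𝒴'ₚ ≃L[ℂ] 𝒴')
    (heX : ∀ x, ‖eX x‖ ≤ ‖x‖) (C : 𝒴' → 𝒳) (ι : 𝒴 →L[ℂ] 𝒴') (H : 𝒳 →L[ℂ] 𝒴) {r r' : ℝ} (hr : r' ≤ r) (Yₚ : 𝒴ₚ)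
    (hex : ∃ X'ₚ : 𝒳ₚ, X'ₚ ∈ closedBall (0 : 𝒳ₚ) r' ∧ (fun Z => eX.symm (C (eY' Z)))
        (((eY'.symm : 𝒴' →L[ℂ] 𝒴'ₚ).comp (ι.comp (e : 𝒴ₚ →L[ℂ] 𝒴))) Yₚ -
          ((eY'.symm : 𝒴' →L[ℂ] 𝒴'ₚ).comp (ι.comp (e : 𝒴ₚ →L[ℂ] 𝒴)))
            (((e.symm : 𝒴 →L[ℂ] 𝒴ₚ).comp (H.comp (eX : 𝒳ₚ →L[ℂ] 𝒳))) X'ₚ)) = X'ₚ)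
    (huniq : ∀ X' ∈ closedBall (0 : 𝒳) r, C (ι (e Yₚ) - ι (H X')) = X' →
      ∀ X'' ∈ closedBall (0 : 𝒳) r, C (ι (e Yₚ) - ι (H X'')) = X'' → X' = X'') :
    landauExp C ι H r (e Yₚ) =
      e (landauExp (fun Z => eX.symm (C (eY' Z))) ((eY'.symm : 𝒴' →L[ℂ] 𝒴'ₚ).comp (ι.comp (e : 𝒴ₚ →L[ℂ] 𝒴)))
        ((e.symm : 𝒴 →L[ℂ] 𝒴ₚ).comp (H.comp (eX : 𝒳ₚ →L[ℂ] 𝒳))) r' Yₚ) := by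
  rw [landauExp_apply, landauExp_apply, corrAt_eq_map_corrAt e eX eY' heX C ι H hr Yₚ hex huniq, map_sub]
  simp only [ContinuousLinearMap.coe_comp, ContinuousLinearEquiv.coe_coe, Function.comp_apply,
    ContinuousLinearEquiv.apply_symm_apply]

end Corr


/-! ## §4 The pinned instance: S69's `WSup (pinW δ′ ϖ) 1 𝔄` read through S65 f2a's identity `toPiL` -/

section Pinned

open Summit.QuantumFields.BalabanUV.T4Continuum.ShellMeasureMultiGridNorms (WSup)
open Summit.QuantumFields.BalabanUV.T4Continuum.ShellMeasurePinnedNorm (pinW norm_toPiL_le_of_nonneg)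

variable {S : Type*} [Fintype S] {𝔄 : Type*} [NormedAddCommGroup 𝔄] [NormedSpace ℂ 𝔄]

/-- **THE FLAT CANONICAL SOLUTION IS `toPiL` OF THE PINNED ONE.**  Flat configuration space `S → 𝔄` (sup norm), pinned
reading `WSup (pinW δ′ ϖ) 1 𝔄` with `0 ≤ δ′`, `0 ≤ ϖ` (so the identity `toPiL` is norm-decreasing, S69), any reading
`eZ : 𝒵ₚ ≃L[ℂ] 𝒵` of the current space; if the scheme CONJUGATED to the pinned spaces has some fixed point of pinned norm
`≤ ε₄′ ≤ ε₄` and the flat scheme has at most one fixed point in `‖X‖ ≤ ε₄`, then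
`solAt 𝒢 Λ W ε₄ J 𝔄 = toPiL (solAt 𝒢ₚ Λₚ Wₚ ε₄′ Jₚ 𝔄ₚ)`. [folklore] -/
theorem solAt_eq_toPiL_solAt {δ' : ℝ} (hδ' : 0 ≤ δ') {ϖ : S → ℝ} (hϖ : ∀ b, 0 ≤ ϖ b) (eZ : 𝒵ₚ ≃L[ℂ] 𝒵)
    (𝒢 : 𝒵 →L[ℂ] (S → 𝔄)) (Λ : (S → 𝔄) →L[ℂ] (S → 𝔄)) (W : (S → 𝔄) → 𝒵) (J : 𝒵) (𝔄₀ : S → 𝔄) {ε₄ ε₄' : ℝ}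
    (hε : ε₄' ≤ ε₄)
    (hex : ∃ Xₚ : WSup (pinW δ' ϖ) 1 𝔄, ‖Xₚ‖ ≤ ε₄' ∧
      mapT (((WSup.toPiL (𝔄 := 𝔄) (pinW δ' ϖ) 1).symm : (S → 𝔄) →L[ℂ] WSup (pinW δ' ϖ) 1 𝔄).comp
          (𝒢.comp (eZ : 𝒵ₚ →L[ℂ] 𝒵)))
        (((WSup.toPiL (𝔄 := 𝔄) (pinW δ' ϖ) 1).symm : (S → 𝔄) →L[ℂ] WSup (pinW δ' ϖ) 1 𝔄).comp
          (Λ.comp ((WSup.toPiL (𝔄 := 𝔄) (pinW δ' ϖ) 1 : WSup (pinW δ' ϖ) 1 𝔄 ≃L[ℂ] (S → 𝔄)) :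
            WSup (pinW δ' ϖ) 1 𝔄 →L[ℂ] (S → 𝔄))))
        (fun Y => eZ.symm (W (WSup.toPiL (𝔄 := 𝔄) (pinW δ' ϖ) 1 Y))) (eZ.symm J)
        ((WSup.toPiL (𝔄 := 𝔄) (pinW δ' ϖ) 1).symm 𝔄₀) Xₚ = Xₚ)
    (huniq : ∀ X' : S → 𝔄, ‖X'‖ ≤ ε₄ → mapT 𝒢 Λ W J 𝔄₀ X' = X' → ∀ X'' : S → 𝔄, ‖X''‖ ≤ ε₄ →
      mapT 𝒢 Λ W J 𝔄₀ X'' = X'' → X' = X'') :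
    solAt 𝒢 Λ W ε₄ J 𝔄₀ =
      WSup.toPiL (𝔄 := 𝔄) (pinW δ' ϖ) 1 (solAt
        (((WSup.toPiL (𝔄 := 𝔄) (pinW δ' ϖ) 1).symm : (S → 𝔄) →L[ℂ] WSup (pinW δ' ϖ) 1 𝔄).comp
          (𝒢.comp (eZ : 𝒵ₚ →L[ℂ] 𝒵)))
        (((WSup.toPiL (𝔄 := 𝔄) (pinW δ' ϖ) 1).symm : (S → 𝔄) →L[ℂ] WSup (pinW δ' ϖ) 1 𝔄).comp
          (Λ.comp ((WSup.toPiL (𝔄 := 𝔄) (pinW δ' ϖ) 1 : WSup (pinW δ' ϖ) 1 𝔄 ≃L[ℂ] (S → 𝔄)) :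
            WSup (pinW δ' ϖ) 1 𝔄 →L[ℂ] (S → 𝔄))))
        (fun Y => eZ.symm (W (WSup.toPiL (𝔄 := 𝔄) (pinW δ' ϖ) 1 Y))) ε₄' (eZ.symm J)
        ((WSup.toPiL (𝔄 := 𝔄) (pinW δ' ϖ) 1).symm 𝔄₀)) :=
  solAt_eq_map_solAt (WSup.toPiL (𝔄 := 𝔄) (pinW δ' ϖ) 1) eZ (norm_toPiL_le_of_nonneg hδ' hϖ) 𝒢 Λ W J 𝔄₀ hε hex huniq

/-- **THE PINNED NORM OF THE FLAT CANONICAL SOLUTION**: under the same hypotheses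
`‖toPiL⁻¹ (solAt 𝒢 Λ W ε₄ J 𝔄)‖_{pin} ≤ ε₄′` — the flat object END-II of record names, measured in S69's norm. [folklore] -/
theorem norm_toPiL_symm_solAt_le {δ' : ℝ} (hδ' : 0 ≤ δ') {ϖ : S → ℝ} (hϖ : ∀ b, 0 ≤ ϖ b) (eZ : 𝒵ₚ ≃L[ℂ] 𝒵)
    (𝒢 : 𝒵 →L[ℂ] (S → 𝔄)) (Λ : (S → 𝔄) →L[ℂ] (S → 𝔄)) (W : (S → 𝔄) → 𝒵) (J : 𝒵) (𝔄₀ : S → 𝔄) {ε₄ ε₄' : ℝ}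
    (hε : ε₄' ≤ ε₄)
    (hex : ∃ Xₚ : WSup (pinW δ' ϖ) 1 𝔄, ‖Xₚ‖ ≤ ε₄' ∧
      mapT (((WSup.toPiL (𝔄 := 𝔄) (pinW δ' ϖ) 1).symm : (S → 𝔄) →L[ℂ] WSup (pinW δ' ϖ) 1 𝔄).comp
          (𝒢.comp (eZ : 𝒵ₚ →L[ℂ] 𝒵)))
        (((WSup.toPiL (𝔄 := 𝔄) (pinW δ' ϖ) 1).symm : (S → 𝔄) →L[ℂ] WSup (pinW δ' ϖ) 1 𝔄).comp
          (Λ.comp ((WSup.toPiL (𝔄 := 𝔄) (pinW δ' ϖ) 1 : WSup (pinW δ' ϖ) 1 𝔄 ≃L[ℂ] (S → 𝔄)) :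
            WSup (pinW δ' ϖ) 1 𝔄 →L[ℂ] (S → 𝔄))))
        (fun Y => eZ.symm (W (WSup.toPiL (𝔄 := 𝔄) (pinW δ' ϖ) 1 Y))) (eZ.symm J)
        ((WSup.toPiL (𝔄 := 𝔄) (pinW δ' ϖ) 1).symm 𝔄₀) Xₚ = Xₚ)
    (huniq : ∀ X' : S → 𝔄, ‖X'‖ ≤ ε₄ → mapT 𝒢 Λ W J 𝔄₀ X' = X' → ∀ X'' : S → 𝔄, ‖X''‖ ≤ ε₄ →
      mapT 𝒢 Λ W J 𝔄₀ X'' = X'' → X' = X'') :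
    ‖(WSup.toPiL (𝔄 := 𝔄) (pinW δ' ϖ) 1).symm (solAt 𝒢 Λ W ε₄ J 𝔄₀)‖ ≤ ε₄' :=
  norm_symm_solAt_le (WSup.toPiL (𝔄 := 𝔄) (pinW δ' ϖ) 1) eZ (norm_toPiL_le_of_nonneg hδ' hϖ) 𝒢 Λ W J 𝔄₀ hε hex huniq

end Pinned

end Summit.QuantumFields.BalabanUV.T4Continuum.ShellMeasureLandauPinnedTransfer

end
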